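import Literature.MathematicalPhysics.QuantumFieldTheory.Balaban1983to89.B8LeafModelZd3
import Literature.MathematicalPhysics.QuantumFieldTheory.Balaban1983to89.B8Thm4ConcreteBdry
import Literature.MathematicalPhysics.QuantumFieldTheory.Balaban1983to89.B8Eq142KLevelLocal

/-!
# `Balaban1983to89.B8LeafModelZd3Bdry` — [Balaban1985RegularSpaces] THEOREM 4 (p. 88) AS `B8.Thm4Body`∕`B8.Thm4Printed` ON n05-a's
# `ℤᵈ × 𝔸` CARRIER `zdGF3`, the (1.59) socket in the REPAIRED currency (exterior-collar term, located repair R-d) — per member and on any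
# index-mapped sub-family (the cube families of (1.131) included)

statement-level skeleton of published theorems with citation tags; proofs where landed; nothing here is a claim about the
Yang–Mills mass gap

PDF held: `paper:balaban1985-cmp99-regular-spaces-gauge-fixing` (journal page = PDF page + 74); pp. 81–83, 86–89, 94–95.

CITATION HEADER (lean-in-tree rule).  Cell `pub-ymgap` (YM Track A, HUMAN RULING D-0062), DAG node N05 = [B8], seat `pub-ymgap-dag-n05-e`
(R141 (C) fan-out), generation g6 — fifth brick of the located repair R-d (`B8Prop3KLevelBdry`, `B8Prop3GaugeFixedKLevelBdry`,
`B8Thm4SupportLocalBdry`, `B8Thm4ConcreteBdry`).  WHY: the member-level sentence `B8.Thm4Body`∕`B8.Thm4Printed` on `zdGF3` was so far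
derived only from the four sockets in the `SockH59` currency (`B8LeafModelZd3.thm4Printed_zd3`, `B8LeafKnitZd3E.thm4Body_member_zd3E`∕
`thm4Printed_zd3_mapE`) — vacuous at every finite-`Ω₀` member (this seat's g5).  THIS FILE is n05-a's assembly VERBATIM on the repaired
driver `B8Thm4ConcreteBdry.thm4Body_concrete_uniform_bdry`: `thm4Body_member_zd3_bdry` (one member, the repaired (1.59) socket stated
INLINE — support clause, exterior-collar term with constant `B_∂`), `thm4Printed_zd3_map_bdry` (any `ι : J → ZdIdx d L`).  With
`J :=` the cube sub-family of `B8Prop6CubeMemberOfPrinted` this is the PROVIDER SHAPE of that file's `H4c` modulo the four sockets at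
the cube members — none of which is certified false.  Kind «kernel-checked proof», theorems only, no `def`.

HONEST SCOPE.  By-name re-threading; the sockets are HYPOTHESES (Prop. 5 ∃ base∕step, Prop. 5 uniqueness (1.109) in the original
currency `SockP5u`, [4] Thm 3.3 with exterior data); `B_∂ ≥ 0` with `4B_∂ ≤ (dL − 1)B₀` is the tree's side condition; the readings of
`B8LeafModelZd3` apply.  Count-neutral; N05 NOT discharged; one finite `𝕋⁴` programme at fixed `ε`, Bałaban as printed; nothing
continuum ∕ ℝ⁴ ∕ OS ∕ mass-gap ∕ Clay.  Unit `pub-ymgap-dag-n05-e` (g6), 2026-08-27.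
-/

noncomputable section

open NormedSpace

namespace Literature.MathematicalPhysics.QuantumFieldTheory.Balaban1983to89.B8LeafModelZd3Bdry

open Complex (I)
open MatrixLog B7Prop1Explicit B7Prop2Explicit B7Prop1Local B7Eq92Concrete
open B7Prop2Explicit (C0 c2')
open B7Prop3Flat (c3)
open B8Ineq132 (covDerivFwd InAk BondTouches)
open B8Eq119TwistedAxial (Restr129 InAx)
open B8Eq184Proof (gaugeExp cfgExp)
open B8Lemma1NonAbelian (mulCfg)
open B8Eq140Level (SideTouches)
open B8Eq146AExpansion (iEta)
open B7Prop4GeneralLevels (logCovIter linCovIter)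
open B8Eq155JBound (Jcur wsup)
open B8ScaledSupNorm (bondNorm msup)
open B8Thm2LogB (blockTop)
open B8Ineq130 (tlo thi)
open B8Eq138LandauZd (IsLandau138W logCfg)
open B8Prop3GaugeFixedKLevel (mem_unitaryUnits_of_mgauge_eq)
open B8Thm4AtLandau138 (mgauge_mgauge_inv)
open B8Thm4ConcreteBdry (thm4Body_concrete_uniform_bdry)
open B8Thm4Windows (thm4_windows thm4_windows_extra)
open B8LeafModelZd (SockP5base SockP5 SockP5u ZdIdx)
open B8LeafModelZd3 (mlogCfg mlogCfg_spec zdGF3)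

-- `Site` alone could resolve to the torus sites of `Setup.lean`; re-export the `ℤ^d` sites of `B7Prop1Explicit`.
export B7Prop1Explicit (Site)

variable {d : ℕ}

variable {𝔸 : Type} [CStarAlgebra 𝔸] [Nontrivial 𝔸]

/-- **`B8.Thm4Body (5dLB₀)` AT ONE MEMBER of `zdGF3`, SOCKETS INSIDE, THE (1.59) SOCKET IN THE REPAIRED CURRENCY** (Theorem 4, p. 88): the
assembly of `B8LeafKnitZd3E.thm4Body_member_zd3E` run on `B8Thm4ConcreteBdry.thm4Body_concrete_uniform_bdry` — ONE threshold `c₁(d, L, B₀,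
B₀′, cu, cP)` before the member; sockets `SockP5base` ∕ `SockP5` ∕ the repaired (1.59) socket (INLINE: support clause «`u = 1` off `Ω₀`»,
both lines `+ B_∂·Φ₀(A′)`) ∕ `SockP5u` AT THAT MEMBER; side condition `0 ≤ B_∂`, `4B_∂ ≤ (dL − 1)B₀`.  (1.37) via the canonical masked
exponent and the (1.42) lemma as landed; proof verbatim.
[cite: Balaban1985RegularSpaces, Thm 4 p.88, (1.29) p.81, (1.37)–(1.38) p.82, (1.58)–(1.62) pp.86–87, Prop. 5 (1.107)–(1.109) p.94, pp.94–95] -/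
theorem thm4Body_member_zd3_bdry (hd2 : 2 ≤ d) {L : ℕ} (hL : 2 ≤ L) (β : ℝ) (len : Site d → ℝ) {B₀ B₀' cu cP Bbd : ℝ} (hB₀ : 0 < B₀)
    (hB₀' : 0 < B₀') (hB : 2 ≤ 5 * (d : ℝ) * L * B₀) (hcu : 0 < cu) (hcP : 0 < cP) (hBbd : 0 ≤ Bbd) (hBd : 4 * Bbd ≤ ((d : ℝ) * L - 1) * B₀) :
    ∃ c₁ : ℝ, 0 < c₁ ∧ ∀ i : ZdIdx d L,
      SockP5base (𝔸 := 𝔸) L B₀ B₀' cP i.η i.k i.Ω i.Λs → SockP5 (𝔸 := 𝔸) L B₀ B₀' cP i.η i.k i.Ω i.Λs →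
      -- the (1.59) socket IN THE REPAIRED CURRENCY at this member (support clause; exterior-collar term with constant `Bbd`)
      (∀ α₀ α₁ : ℝ, 0 < α₀ → 0 < α₁ → α₀ + α₁ ≤ cP →
        ∀ U₀ U' : Site d → Fin d → 𝔸ˣ, (∀ x κ, U₀ x κ ∈ unitaryUnits 𝔸) → (∀ x κ, U' x κ ∈ unitaryUnits 𝔸) →
        InAk L i.k i.η α₀ i.Ω U₀ → InAk L i.k i.η α₀ i.Ω (mulCfg U' U₀) → (∀ m, m ≤ i.k → InAx L m (i.Λs m) U₀ (mulCfg U' U₀)) →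
        (∀ j, j ≤ i.k → ∀ (z : Site d) (μ : Fin d), (∀ x, InBox (loK L j z) (bondHiK L j z μ) x → x ∈ i.Ω j) →
          ‖(avgIter L (mulCfg U' U₀) j z μ : 𝔸) - (avgIter L U₀ j z μ : 𝔸)‖ ≤ α₁) →
        (∀ b ∈ {b : Site d × Fin d | SideTouches (i.Ω 0) b.1 b.2}, ‖((U' b.1 b.2 : 𝔸ˣ) : 𝔸) - 1‖ ≤ α₁) →
        (∀ m, 1 ≤ m → m ≤ i.k → ∀ (u : Site d → 𝔸ˣ) (W : Site d → Fin d → 𝔸ˣ) (A' : Site d → Fin d → 𝔸),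
          (∀ x, u x ∈ unitaryUnits 𝔸) → (∀ x, x ∉ i.Ω 0 → u x = 1) → mgauge U₀ u W = U' → Restr129 L m (i.Λs m) U₀ u →
          IsLandau138W L m i.η (i.Ω 0) (i.Λs m) U₀ W → (∀ y τ, IsSelfAdjoint (A' y τ)) →
          (∀ j, j ≤ m → ∀ y τ, SideTouches (i.Ω j) y τ →
          W y τ = cfgExp i.η A' y τ ∧ ‖A' y τ‖ ≤ (2 * (L * (5 * (d : ℝ) * L * B₀ * (α₀ + α₁))) + 8 * (8 * B₀' * (5 * (d : ℝ) * L * B₀) * (α₀ + α₁))) * ((L : ℝ) ^ j * i.η)⁻¹) →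
          (∀ y τ, (∀ j, j ≤ m → ¬ SideTouches (i.Ω j) y τ) → A' y τ = 0) →
          msup L m i.η (-(1 : ℝ)) (fun j (b : Site d × Fin d) => SideTouches (i.Ω j) b.1 b.2) (fun b => A' b.1 b.2)
          ≤ B₀ * (bondNorm L m i.η (-(3 : ℝ)) i.Ω (fun x μ => Jcur i.η U₀ A' μ x)
          + wsup 1 (fun p : {p : ℕ × (Site d × Fin d) // p.1 ≤ m ∧ p.2 ∈ i.Λb m p.1} =>
          linCovIter L U₀ (iEta i.η A') p.1.1 p.1.2.1 p.1.2.2))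
          + Bbd * msup L m i.η (-(1 : ℝ)) (fun j (b : Site d × Fin d) => j = 0 ∧ SideTouches (i.Ω 0) b.1 b.2 ∧ ¬ BondTouches (i.Ω 0) b.1 b.2)
              (fun b => A' b.1 b.2) ∧
          msup L m i.η (-(2 : ℝ)) (fun j (t : Fin d × Fin d × Site d) => SideTouches (i.Ω j) t.2.2 t.2.1)
          (fun t => covDerivFwd i.η U₀ t.1 (fun z => A' z t.2.1) t.2.2)
          ≤ B₀ * (bondNorm L m i.η (-(3 : ℝ)) i.Ω (fun x μ => Jcur i.η U₀ A' μ x)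
          + wsup 1 (fun p : {p : ℕ × (Site d × Fin d) // p.1 ≤ m ∧ p.2 ∈ i.Λb m p.1} =>
          linCovIter L U₀ (iEta i.η A') p.1.1 p.1.2.1 p.1.2.2))
          + Bbd * msup L m i.η (-(1 : ℝ)) (fun j (b : Site d × Fin d) => j = 0 ∧ SideTouches (i.Ω 0) b.1 b.2 ∧ ¬ BondTouches (i.Ω 0) b.1 b.2)
              (fun b => A' b.1 b.2))) →
      SockP5u (𝔸 := 𝔸) L cP cu i.η i.k i.Ω i.Λs →
      B8.Thm4Body c₁ (5 * (d : ℝ) * L * B₀) (fun _ : Unit => (zdGF3 𝔸 L β len i).toGFData) := by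
  have hL1 : 1 ≤ L := le_trans (by norm_num) hL
  have hd1 : 1 ≤ d := le_trans (by norm_num) hd2
  have hL' : (1 : ℝ) ≤ L := by exact_mod_cast hL1
  obtain ⟨c₁, hc₁, H⟩ := thm4Body_concrete_uniform_bdry (𝔸 := 𝔸) hd2 hL hB₀ hB₀' hB hcu hcP hBbd hBd
  obtain ⟨cw, hcw, hw⟩ := thm4_windows hd1 hL1 hB₀ hB₀' hB
  obtain ⟨cw', hcw', hw'⟩ := thm4_windows_extra (d := d) hL1
  refine ⟨min c₁ (min cw cw'), lt_min hc₁ (lt_min hcw hcw'), ?_⟩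
  intro i SP5base SP5 SH59D SP5u _ α₀ α₁ hα₀ hα₁ hs U₀ P hInA _ hInAAx h166
  have hs₁ : α₀ + α₁ ≤ c₁ := hs.trans (min_le_left _ _)
  have hsw : α₀ + α₁ ≤ cw := hs.trans ((min_le_right _ _).trans (min_le_left _ _))
  have hsw' : α₀ + α₁ ≤ cw' := hs.trans ((min_le_right _ _).trans (min_le_right _ _))
  obtain ⟨hP1, h34, hAx⟩ := hInAAx
  obtain ⟨h135, h66⟩ := h166
  subst hP1
  obtain ⟨u, hu, huS, h129, hLan, hleaf, huniq⟩ := H i.η i.hη i.k i.Ω i.hΩ i.Λs i.Λb i.hbox i.hclass i.htower i.hpart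
    SP5base SP5 SH59D SP5u α₀ α₁ hα₀ hα₁ hs₁ P.1.1 P.2.1 P.1.2 P.2.2 hInA h34 hAx h135 h66
  -- windows for the (1.42) lemma
  obtain ⟨-, -, -, -, w5, w6, w7, -, w9, w10, -, -, -, -, -, -, -, -⟩ :=
    hw α₀ α₁ hα₀ hα₁ hsw (5 * (d : ℝ) * L * B₀ * (α₀ + α₁)) (8 * B₀' * (5 * (d : ℝ) * L * B₀) * (α₀ + α₁)) rfl rfl
  obtain ⟨w19, -⟩ := hw' α₀ α₁ hα₀ hα₁ hsw'
  have hcs0 : 0 ≤ 5 * (d : ℝ) * L * B₀ * (α₀ + α₁) := by positivity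
  have hKS0 : 0 ≤ 2 * (L * (5 * (d : ℝ) * L * B₀ * (α₀ + α₁))) + 8 * (8 * B₀' * (5 * (d : ℝ) * L * B₀) * (α₀ + α₁)) := by
    positivity
  have hcK : 5 * (d : ℝ) * L * B₀ * (α₀ + α₁) ≤
      2 * (L * (5 * (d : ℝ) * L * B₀ * (α₀ + α₁))) + 8 * (8 * B₀' * (5 * (d : ℝ) * L * B₀) * (α₀ + α₁)) := by
    have h₁ : (1 : ℝ) * (5 * (d : ℝ) * L * B₀ * (α₀ + α₁)) ≤ L * (5 * (d : ℝ) * L * B₀ * (α₀ + α₁)) :=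
      mul_le_mul_of_nonneg_right hL' hcs0
    have h₂ : 0 ≤ 8 * (8 * B₀' * (5 * (d : ℝ) * L * B₀) * (α₀ + α₁)) := by positivity
    linarith
  have hc16 : 16 * (5 * (d : ℝ) * L * B₀ * (α₀ + α₁)) ≤ 1 := by linarith
  -- the gauge-fixed field and its CANONICAL masked exponent
  have hW : mgauge P.1.1 u (mgauge P.1.1 u⁻¹ P.2.1) = P.2.1 := mgauge_mgauge_inv P.1.1 P.2.1 u
  have hWu : ∀ x κ, mgauge P.1.1 u⁻¹ P.2.1 x κ ∈ unitaryUnits 𝔸 := mem_unitaryUnits_of_mgauge_eq P.1.2 P.2.2 hu hW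
  have hWA : ∀ j, j ≤ i.k → ∀ y τ, SideTouches (i.Ω j) y τ →
      mgauge P.1.1 u⁻¹ P.2.1 y τ = cfgExp i.η (logCfg i.η (mgauge P.1.1 u⁻¹ P.2.1)) y τ ∧
        ‖logCfg i.η (mgauge P.1.1 u⁻¹ P.2.1) y τ‖ ≤ (5 * (d : ℝ) * L * B₀ * (α₀ + α₁)) * ((L : ℝ) ^ j * i.η)⁻¹ :=
    fun j hj y τ h => ⟨(hleaf j hj (y, τ) h).1, (hleaf j hj (y, τ) h).2.2⟩
  obtain ⟨hA'sa, hA'eq, hA'zero⟩ := mlogCfg_spec i.hη hL1 i.k P.1.1 hWu hcs0 hc16 i.Ω hWA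
  set A' := mlogCfg i.k i.η i.Ω (mgauge P.1.1 u⁻¹ P.2.1) with hA'_def
  have hA'bd : ∀ j, j ≤ i.k → ∀ y τ, SideTouches (i.Ω j) y τ →
      mgauge P.1.1 u⁻¹ P.2.1 y τ = cfgExp i.η A' y τ ∧
        ‖A' y τ‖ ≤ (2 * (L * (5 * (d : ℝ) * L * B₀ * (α₀ + α₁))) + 8 * (8 * B₀' * (5 * (d : ℝ) * L * B₀) * (α₀ + α₁))) *
          ((L : ℝ) ^ j * i.η)⁻¹ := by
    intro j hj y τ h
    obtain ⟨hAA, hWexp⟩ := hA'eq j hj y τ h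
    refine ⟨hWexp, ?_⟩
    rw [hAA]
    have hη0 : 0 ≤ i.η := i.hη.le
    exact ((hWA j hj y τ h).2).trans (mul_le_mul_of_nonneg_right hcK (by positivity))
  have h137 := B8Eq142KLevelLocal.H42_of_inAx hd2 i.hη hL i.k P.1.2 hα₀ hα₁ hKS0 w5 w6 w7 w9 w10 w19 i.Ω i.hΩ i.Λs i.Λb i.hbox
    i.hclass hInA h34 hAx h135 (fun m W => IsLandau138W L m i.η (i.Ω 0) (i.Λs m) P.1.1 W) i.k i.hk le_rfl u
    (mgauge P.1.1 u⁻¹ P.2.1) A' hu hW h129 (hLan i.hk) hA'sa hA'bd hA'zero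
  refine ⟨⟨u, hu, huS⟩, h129, ⟨h137, hLan i.hk, ?_⟩, ?_⟩
  · intro j hj b hb
    exact hleaf j hj b hb
  · intro u' hR' _ hLan' h162'
    apply Subtype.ext
    refine huniq u'.1 u'.2.1 u'.2.2 hR' hLan' ⟨logCfg i.η (mgauge P.1.1 u'.1⁻¹ P.2.1), fun j hj x κ h => ?_⟩ i.hk
    exact ⟨(h162' j hj (x, κ) h).1, (h162' j hj (x, κ) h).2.2⟩

/-- **`B8.Thm4Printed (5dLB₀)` ON AN INDEX-MAPPED SUB-FAMILY `fam₃ ∘ ι`** of `zdGF3` (`ι : J → ZdIdx d L`), from the four sockets on the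
image of `ι` only, the (1.59) socket in the repaired currency (INLINE, per member).  At `J :=` the cube sub-family this is the provider
shape of `B8Prop6CubeMemberOfPrinted`'s binder `H4c`. [cite: Balaban1985RegularSpaces, Thm 4 p.88, Prop. 5 p.94, (1.59) p.86] -/
theorem thm4Printed_zd3_map_bdry (hd2 : 2 ≤ d) {L : ℕ} (hL : 2 ≤ L) {β : ℝ} {len : Site d → ℝ} {B₀ B₀' cu cP Bbd : ℝ} (hB₀ : 0 < B₀)
    (hB₀' : 0 < B₀') (hB : 2 ≤ 5 * (d : ℝ) * L * B₀) (hcu : 0 < cu) (hcP : 0 < cP) (hBbd : 0 ≤ Bbd) (hBd : 4 * Bbd ≤ ((d : ℝ) * L - 1) * B₀)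
    {J : Type} (ι : J → ZdIdx d L)
    (SP5base : ∀ j : J, SockP5base (𝔸 := 𝔸) L B₀ B₀' cP (ι j).η (ι j).k (ι j).Ω (ι j).Λs)
    (SP5 : ∀ j : J, SockP5 (𝔸 := 𝔸) L B₀ B₀' cP (ι j).η (ι j).k (ι j).Ω (ι j).Λs)
    (SH59D : ∀ j : J, ∀ α₀ α₁ : ℝ, 0 < α₀ → 0 < α₁ → α₀ + α₁ ≤ cP →
        ∀ U₀ U' : Site d → Fin d → 𝔸ˣ, (∀ x κ, U₀ x κ ∈ unitaryUnits 𝔸) → (∀ x κ, U' x κ ∈ unitaryUnits 𝔸) →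
        InAk L (ι j).k (ι j).η α₀ (ι j).Ω U₀ → InAk L (ι j).k (ι j).η α₀ (ι j).Ω (mulCfg U' U₀) →
        (∀ m, m ≤ (ι j).k → InAx L m ((ι j).Λs m) U₀ (mulCfg U' U₀)) →
        (∀ j', j' ≤ (ι j).k → ∀ (z : Site d) (μ : Fin d), (∀ x, InBox (loK L j' z) (bondHiK L j' z μ) x → x ∈ (ι j).Ω j') →
          ‖(avgIter L (mulCfg U' U₀) j' z μ : 𝔸) - (avgIter L U₀ j' z μ : 𝔸)‖ ≤ α₁) →
        (∀ b ∈ {b : Site d × Fin d | SideTouches ((ι j).Ω 0) b.1 b.2}, ‖((U' b.1 b.2 : 𝔸ˣ) : 𝔸) - 1‖ ≤ α₁) →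
        (∀ m, 1 ≤ m → m ≤ (ι j).k → ∀ (u : Site d → 𝔸ˣ) (W : Site d → Fin d → 𝔸ˣ) (A' : Site d → Fin d → 𝔸),
          (∀ x, u x ∈ unitaryUnits 𝔸) → (∀ x, x ∉ (ι j).Ω 0 → u x = 1) → mgauge U₀ u W = U' → Restr129 L m ((ι j).Λs m) U₀ u →
          IsLandau138W L m (ι j).η ((ι j).Ω 0) ((ι j).Λs m) U₀ W → (∀ y τ, IsSelfAdjoint (A' y τ)) →
          (∀ j', j' ≤ m → ∀ y τ, SideTouches ((ι j).Ω j') y τ →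
          W y τ = cfgExp (ι j).η A' y τ ∧ ‖A' y τ‖ ≤ (2 * (L * (5 * (d : ℝ) * L * B₀ * (α₀ + α₁))) + 8 * (8 * B₀' * (5 * (d : ℝ) * L * B₀) * (α₀ + α₁))) * ((L : ℝ) ^ j' * (ι j).η)⁻¹) →
          (∀ y τ, (∀ j', j' ≤ m → ¬ SideTouches ((ι j).Ω j') y τ) → A' y τ = 0) →
          msup L m (ι j).η (-(1 : ℝ)) (fun j' (b : Site d × Fin d) => SideTouches ((ι j).Ω j') b.1 b.2) (fun b => A' b.1 b.2)
          ≤ B₀ * (bondNorm L m (ι j).η (-(3 : ℝ)) (ι j).Ω (fun x μ => Jcur (ι j).η U₀ A' μ x)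
          + wsup 1 (fun p : {p : ℕ × (Site d × Fin d) // p.1 ≤ m ∧ p.2 ∈ (ι j).Λb m p.1} =>
          linCovIter L U₀ (iEta (ι j).η A') p.1.1 p.1.2.1 p.1.2.2))
          + Bbd * msup L m (ι j).η (-(1 : ℝ)) (fun j' (b : Site d × Fin d) => j' = 0 ∧ SideTouches ((ι j).Ω 0) b.1 b.2 ∧ ¬ BondTouches ((ι j).Ω 0) b.1 b.2)
              (fun b => A' b.1 b.2) ∧
          msup L m (ι j).η (-(2 : ℝ)) (fun j' (t : Fin d × Fin d × Site d) => SideTouches ((ι j).Ω j') t.2.2 t.2.1)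
          (fun t => covDerivFwd (ι j).η U₀ t.1 (fun z => A' z t.2.1) t.2.2)
          ≤ B₀ * (bondNorm L m (ι j).η (-(3 : ℝ)) (ι j).Ω (fun x μ => Jcur (ι j).η U₀ A' μ x)
          + wsup 1 (fun p : {p : ℕ × (Site d × Fin d) // p.1 ≤ m ∧ p.2 ∈ (ι j).Λb m p.1} =>
          linCovIter L U₀ (iEta (ι j).η A') p.1.1 p.1.2.1 p.1.2.2))
          + Bbd * msup L m (ι j).η (-(1 : ℝ)) (fun j' (b : Site d × Fin d) => j' = 0 ∧ SideTouches ((ι j).Ω 0) b.1 b.2 ∧ ¬ BondTouches ((ι j).Ω 0) b.1 b.2)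
              (fun b => A' b.1 b.2)))
    (SP5u : ∀ j : J, SockP5u (𝔸 := 𝔸) L cP cu (ι j).η (ι j).k (ι j).Ω (ι j).Λs) :
    B8.Thm4Printed (5 * (d : ℝ) * L * B₀) (fun j : J => (zdGF3 𝔸 L β len (ι j)).toGFData) := by
  obtain ⟨c₁, hc₁, H⟩ := thm4Body_member_zd3_bdry (𝔸 := 𝔸) hd2 hL β len hB₀ hB₀' hB hcu hcP hBbd hBd
  exact ⟨c₁, hc₁, fun j => H (ι j) (SP5base j) (SP5 j) (SH59D j) (SP5u j) ()⟩

#print axioms thm4Body_member_zd3_bdry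
#print axioms thm4Printed_zd3_map_bdry

end Literature.MathematicalPhysics.QuantumFieldTheory.Balaban1983to89.B8LeafModelZd3Bdry

end
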